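import Summits.AtomisticToContinuum.Crystallization.Theorems.OverbindingBudgetElasticSplitScale
import Summits.AtomisticToContinuum.Crystallization.Theorems.ContactSaturationLadderDirectionalCharge

/-!
# OverbindingBudget — «ElasticSplit» (5): the SHEAR TEST by cross-route concordance with ContactSaturationLadder's directional charge
(decomp-a2c lens-4, generation 27)

Helper file (`--supports stmt-AtomisticToContinuum-31280`).  Files 1–4 (`…ElasticSplitStatements/Dilation/Pricing/Scale`) cut the
edge-relaxation law RELAX into a dense-charge branch (⟸ `ChargedEnergyGap`), the DILATION test (isotropic first-order strain,
PROVED), the local relaxation test, and the residual `BalancedLiouvilleLaw` on uncompressed, sparse-charge, locally optimal,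
VIRIAL-BALANCED strained clean textures.  The dilation test prices only the TRACE of the window-averaged stress.  Route
ContactSaturationLadder (decomp-a2c lens-1, g26) landed the companion for the five DEVIATORIC / uniaxial modes in configuration-free
form: `ContactSaturationLadderDirectionalCharge.directionalCharge_le` — for distinct points, every index window `W` and every unit
vector `u`, `min (3 (Vᵘ)² / (392 D₁₂ᵘ)) (|Vᵘ| / 80) ≤ 𝓔(y|W) − #W·e⋆`, `Vᵘ = D₁₂ᵘ − D₆ᵘ` the uniaxial virial (directional lattice
sums weighted by `cos²` of the pair direction against `u`).  This file imports it BY NAME (second cross-route concordance of the node,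
after `ChargedEnergyGap → ChargeDensityRelax`) and turns it into a test on textures:

* `shearGain u F` — the directional charge of the chunk `F` (its own injective enumeration, full window) in direction `u`;
  `floor_add_shearGain_le : #F·e⋆ + shearGain u F ≤ ½∑∑_F V_LJ` (= `directionalCharge_le`, re-indexed);
* `ShearStrainedCubes κ u Y` (cofinal cubes with `shearGain u ≥ κ ℓ³`), `StressFree Y` (no direction, no rate);
* `strainedCubes_of_shearStrained : UniformlyDiscrete Y → ‖u‖ = 1 → 0 < κ → ShearStrainedCubes κ u Y → StrainedCubes (κ/2) Y`
  (the bulk floor `#F·e⋆` is converted into the finite ground-state currency `E(#F)` of RELAX by `E(N) ≤ (e⋆ + ε)N` eventually,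
  `…ElasticSplitPricing.groundStateEnergy_le_eventually`, and cube packing; the chunk is large because the gain is at most
  `250(δ⁻¹² + δ⁻⁶)·#F`);
* the residual shrinks to `ShearFreeLiouvilleLaw T₀ D` := `BalancedLiouvilleLaw` with the added hypothesis `StressFree Y`
  (KERNEL-WEAKER), `balancedLiouvilleLaw_of_shearFree` (PROVED, exhaustive case split), and the cone
  `rdef_of_grossU_shearSplit_record : GrossCleanBallsU (1/250) 10 → ChargedEnergyGap → LocalRelaxationTest (1/250) 10 →
   CompressedVirialLaw (1/250) 10 → ShearFreeLiouvilleLaw (1/250) 10 → CleanlessExcessT → CoherentResidual 10 → RobustDefectLimitWindows`.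

What the shear test buys (memo §3′ of the node card): every texture whose window-AVERAGED affine strain response is non-zero of volume
order in SOME direction — homogeneously sheared or uniaxially strained Barlow textures at zero pressure (the dead end «pressure-only
Liouville is false: sheared fcc» of the node's design), LONG-typed textures stretched along one axis, CONTRAST produced by a homogeneous
deviatoric strain — relaxes by volume order, with no charge hypothesis and no comparison structure.  What remains in the residual are
strained textures whose averaged stress tensor vanishes on all large cubes: INHOMOGENEOUS equilibrated strain fields (the genuine
Liouville content) and TCP-like phases at their own optimal cell (excluded here by sparse charge).
-/

namespace Summit.AtomisticToContinuum.Crystallization.Theorems.OverbindingBudgetElasticSplitShear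

open scoped BigOperators Classical
open Literature.MathematicalPhysics.StatisticalMechanics (lennardJones lennardJones_zero groundStateEnergy PeriodicConfiguration
  UniformlyDiscrete)
open Summit.AtomisticToContinuum.Crystallization.Theses.OverbindingBudget (RobustDefectLimitWindows)
open Summit.AtomisticToContinuum.Crystallization.Theses.PricedLinkCensus (ChargedEnergyGap)
open Summit.AtomisticToContinuum.Crystallization.Theorems.OverbindingBudgetGradedBareness (CleanlessExcessT)
open Summit.AtomisticToContinuum.Crystallization.Theorems.OverbindingBudgetCoherentCut (CoherentResidual)
open Summit.AtomisticToContinuum.Crystallization.Theorems.OverbindingBudgetUniformCutStatements (GrossCleanBallsU)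
open Summit.AtomisticToContinuum.Crystallization.Theorems.OverbindingBudgetCubeTails (card_le_of_separated_of_box)
open Summit.AtomisticToContinuum.Crystallization.Theorems.OverbindingBudgetRecurrentDustStatements (ViolatorsL)
open Summit.AtomisticToContinuum.Crystallization.Theorems.OverbindingBudgetEdgeRelaxationStatements (StrainedCubes CleanClass
  EdgeRelaxationLaw)
open Summit.AtomisticToContinuum.Crystallization.Theorems.OverbindingBudgetElasticSplitStatements
open Summit.AtomisticToContinuum.Crystallization.Theorems.OverbindingBudgetElasticSplitDilation (enum enum_injective sum_sum_enum)
open Summit.AtomisticToContinuum.Crystallization.Theorems.OverbindingBudgetElasticSplitPricing (groundStateEnergy_le_eventually)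
open Summit.AtomisticToContinuum.Crystallization.Theorems.OverbindingBudgetElasticSplitScale
open Summit.AtomisticToContinuum.Crystallization.Theorems.ContactSaturationLadderDilationCharge (sum_inv_pow_twelve_le_of_separated)
open Summit.AtomisticToContinuum.Crystallization.Theorems.ContactSaturationLadderDirectionalCharge (directionalCharge_le dirSum_le_sum
  sum_inv_pow_six_le_of_separated)

/-! ## §1 The directional charge of a chunk -/

/-- The directional lattice sum `Dₙᵘ(F) = Σ_{i} Σ_{k ≠ i} |yᵢ − yₖ|⁻ⁿ · (⟪u, yₖ − yᵢ⟫ / |yᵢ − yₖ|)²` of a chunk `F` (enumerated by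
`…ElasticSplitDilation.enum F`), in the currency of `ContactSaturationLadderDirectionalCharge`. -/
noncomputable def dirSum (n : ℕ) (u : EuclideanSpace ℝ (Fin 3)) (F : Finset (EuclideanSpace ℝ (Fin 3))) : ℝ :=
  ∑ i ∈ (Finset.univ : Finset (Fin F.card)), ∑ k ∈ (Finset.univ : Finset (Fin F.card)).erase i,
    (dist (enum F i) (enum F k))⁻¹ ^ n * (inner ℝ u (enum F k - enum F i) / dist (enum F i) (enum F k)) ^ 2

/-- **The shear gain** of a chunk in direction `u`: `min (3 (D₁₂ᵘ − D₆ᵘ)² / (392 D₁₂ᵘ)) (|D₁₂ᵘ − D₆ᵘ| / 80)` — the directional charge of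
route ContactSaturationLadder, a lower bound for the energy released by the optimal uniaxial stretch `x ↦ x + τ⟪u, x⟫u` of the chunk
measured against the bulk floor. -/
noncomputable def shearGain (u : EuclideanSpace ℝ (Fin 3)) (F : Finset (EuclideanSpace ℝ (Fin 3))) : ℝ :=
  min (3 * (dirSum 12 u F - dirSum 6 u F) ^ 2 / (392 * dirSum 12 u F)) (|dirSum 12 u F - dirSum 6 u F| / 80)

/-- `ShearStrainedCubes κ u Y`: cofinally in `ℓ`, some cube chunk has shear gain `≥ κ ℓ³` in direction `u` (its window-averaged
uniaxial virial along `u` is off balance by a volume-order amount). -/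
def ShearStrainedCubes (κ : ℝ) (u : EuclideanSpace ℝ (Fin 3)) (Y : Set (EuclideanSpace ℝ (Fin 3))) : Prop :=
  ∀ ℓ₀ : ℝ, ∃ ℓ : ℝ, ℓ₀ ≤ ℓ ∧ ∃ c : EuclideanSpace ℝ (Fin 3), ∃ F : Finset (EuclideanSpace ℝ (Fin 3)),
    (↑F : Set (EuclideanSpace ℝ (Fin 3))) = Y ∩ {z | ∀ i : Fin 3, c i ≤ z i ∧ z i < c i + ℓ} ∧ κ * ℓ ^ 3 ≤ shearGain u F

/-- `StressFree Y`: the texture passes the shear test in EVERY direction at EVERY volume rate (all large cube chunks have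
window-averaged uniaxial virial `o(ℓ³)` along every unit vector). -/
def StressFree (Y : Set (EuclideanSpace ℝ (Fin 3))) : Prop :=
  ∀ u : EuclideanSpace ℝ (Fin 3), ‖u‖ = 1 → ∀ κ : ℝ, 0 < κ → ¬ ShearStrainedCubes κ u Y

/-! ## §2 The competitor bound (imported) and the size of a charged chunk -/

/-- Re-indexing: the erased double sum of `V_LJ` over the enumeration is the chunk's double sum (`V_LJ(0) = 0` on the diagonal). -/
theorem half_sum_erase_enum (F : Finset (EuclideanSpace ℝ (Fin 3))) :
    (1 / 2) * ∑ i ∈ (Finset.univ : Finset (Fin F.card)), ∑ k ∈ (Finset.univ : Finset (Fin F.card)).erase i,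
        lennardJones (dist (enum F i) (enum F k)) =
      1 / 2 * ∑ y ∈ F, ∑ w ∈ F, lennardJones (dist y w) := by
  rw [← sum_sum_enum F (fun a b => lennardJones (dist a b))]
  congr 1
  refine Finset.sum_congr rfl fun i _ => ?_
  exact Finset.sum_erase _ (by rw [dist_self, lennardJones_zero])

/-- **The shear competitor bound** (`directionalCharge_le` of route ContactSaturationLadder, re-indexed to chunks):
`#F·e⋆ + shearGain u F ≤ ½∑∑_F V_LJ` for every finite chunk and every unit vector. -/
theorem floor_add_shearGain_le (F : Finset (EuclideanSpace ℝ (Fin 3))) {u : EuclideanSpace ℝ (Fin 3)} (hu : ‖u‖ = 1) :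
    (F.card : ℝ) * (⨅ Q : PeriodicConfiguration 3, Q.energyPerParticle lennardJones) + shearGain u F ≤
      1 / 2 * ∑ y ∈ F, ∑ w ∈ F, lennardJones (dist y w) := by
  have h := directionalCharge_le (enum_injective F) (Finset.univ : Finset (Fin F.card)) hu
  rw [Finset.card_univ, Fintype.card_fin, half_sum_erase_enum F] at h
  unfold shearGain dirSum
  linarith

/-- The shear gain of a `δ`-separated chunk is at most `250 (δ⁻¹² + δ⁻⁶) · #F` (directional sums ≤ full sums ≤ shell bounds). -/
theorem shearGain_le_card (F : Finset (EuclideanSpace ℝ (Fin 3))) {u : EuclideanSpace ℝ (Fin 3)} (hu : ‖u‖ = 1) {δ : ℝ}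
    (hδ : 0 < δ) (hsep : ∀ y ∈ F, ∀ w ∈ F, y ≠ w → δ ≤ dist y w) :
    shearGain u F ≤ 250 * (δ⁻¹ ^ 12 + δ⁻¹ ^ 6) * (F.card : ℝ) := by
  have hsep' : ∀ k l : Fin F.card, k ≠ l → δ ≤ dist (enum F k) (enum F l) := fun k l hkl =>
    hsep _ (Finset.coe_mem _) _ (Finset.coe_mem _) fun h => hkl (enum_injective F h)
  have h12 : dirSum 12 u F ≤ 250 * δ⁻¹ ^ 12 * (F.card : ℝ) := by
    have h := (dirSum_le_sum (enum F) Finset.univ hu 12).trans (sum_inv_pow_twelve_le_of_separated (enum F) Finset.univ hδ hsep')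
    rw [Finset.card_univ, Fintype.card_fin] at h
    exact h
  have h6 : dirSum 6 u F ≤ 250 * δ⁻¹ ^ 6 * (F.card : ℝ) := by
    have h := (dirSum_le_sum (enum F) Finset.univ hu 6).trans (sum_inv_pow_six_le_of_separated (enum F) Finset.univ hδ hsep')
    rw [Finset.card_univ, Fintype.card_fin] at h
    exact h
  have h12nn : 0 ≤ dirSum 12 u F := by
    unfold dirSum
    exact Finset.sum_nonneg fun i _ => Finset.sum_nonneg fun k _ => by positivity
  have h6nn : 0 ≤ dirSum 6 u F := by
    unfold dirSum
    exact Finset.sum_nonneg fun i _ => Finset.sum_nonneg fun k _ => by positivity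
  have habs : |dirSum 12 u F - dirSum 6 u F| ≤ dirSum 12 u F + dirSum 6 u F := by
    rw [abs_le]
    constructor <;> linarith
  calc shearGain u F ≤ |dirSum 12 u F - dirSum 6 u F| / 80 := min_le_right _ _
    _ ≤ (dirSum 12 u F + dirSum 6 u F) / 80 := div_le_div_of_nonneg_right habs (by norm_num)
    _ ≤ dirSum 12 u F + dirSum 6 u F := by linarith
    _ ≤ 250 * (δ⁻¹ ^ 12 + δ⁻¹ ^ 6) * (F.card : ℝ) := by linarith

/-! ## §3 The shear test -/

/-- **THE SHEAR TEST**: a uniformly discrete texture with shear-strained cubes at rate `κ` in some direction has strained cubes at rate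
`κ/2` — the optimally stretched chunk (through the bulk floor) beats the finite ground state with as many atoms by `κ ℓ³ / 2`. -/
theorem strainedCubes_of_shearStrained {κ : ℝ} {u : EuclideanSpace ℝ (Fin 3)} {Y : Set (EuclideanSpace ℝ (Fin 3))}
    (hY : UniformlyDiscrete Y) (hu : ‖u‖ = 1) (hκ : 0 < κ) (h : ShearStrainedCubes κ u Y) : StrainedCubes (κ / 2) Y := by
  obtain ⟨δ, hδ, hsep⟩ := hY
  set e : ℝ := ⨅ Q : PeriodicConfiguration 3, Q.energyPerParticle lennardJones with he
  set B : ℝ := 27 / δ ^ 3 with hB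
  have hBpos : 0 < B := by positivity
  set A : ℝ := 250 * (δ⁻¹ ^ 12 + δ⁻¹ ^ 6) with hA
  have hApos : 0 < A := by positivity
  set ε : ℝ := κ / (2 * B) with hε
  have hεpos : 0 < ε := by positivity
  obtain ⟨N₁, -, hN₁⟩ := groundStateEnergy_le_eventually hεpos
  intro ℓ₀
  set ℓ₁ : ℝ := max (max ℓ₀ (max 1 δ)) (A * N₁ / κ) with hℓ₁
  obtain ⟨ℓ, hℓ, c, F, hFcoe, hgain⟩ := h ℓ₁
  have hℓ₀ : ℓ₀ ≤ ℓ := le_trans (le_trans (le_max_left _ _) (le_max_left _ _)) hℓ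
  have hℓ1 : 1 ≤ ℓ := le_trans (le_trans (le_trans (le_max_left _ _) (le_max_right _ _)) (le_max_left _ _)) hℓ
  have hℓN : A * N₁ / κ ≤ ℓ := le_trans (le_max_right _ _) hℓ
  have hℓpos : 0 < ℓ := by linarith
  have hℓ3 : ℓ ≤ ℓ ^ 3 := by
    have h1 : (1 : ℝ) ≤ ℓ ^ 2 := one_le_pow₀ hℓ1
    calc ℓ = ℓ * 1 := (mul_one ℓ).symm
      _ ≤ ℓ * ℓ ^ 2 := mul_le_mul_of_nonneg_left h1 hℓpos.le
      _ = ℓ ^ 3 := by ring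
  have hmem : ∀ z ∈ F, z ∈ Y ∧ ∀ i : Fin 3, c i ≤ z i ∧ z i < c i + ℓ := by
    intro z hz
    have hz' : z ∈ (↑F : Set (EuclideanSpace ℝ (Fin 3))) := hz
    rw [hFcoe] at hz'
    exact hz'
  have hsepF : ∀ y ∈ F, ∀ w ∈ F, y ≠ w → δ ≤ dist y w := fun y hy w hw hyw => hsep y (hmem y hy).1 w (hmem w hw).1 hyw
  -- counts: `κ ℓ³ ≤ gain ≤ A · #F` and `#F ≤ B ℓ³`
  have hNlow : κ * ℓ ^ 3 ≤ A * (F.card : ℝ) := hgain.trans (shearGain_le_card F hu hδ hsepF)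
  have hNB : (F.card : ℝ) ≤ B * ℓ ^ 3 := by
    have hbox := card_le_of_separated_of_box F (fun i => c i) (fun _ => ℓ) hδ (fun _ => hℓpos.le)
      (fun z hz i => (hmem z hz).2 i) hsepF
    rw [Finset.prod_const, Finset.card_univ, Fintype.card_fin] at hbox
    have h3 : 2 * ℓ / δ + 1 ≤ 3 * ℓ / δ := by
      rw [div_add_one (ne_of_gt hδ), div_le_div_iff_of_pos_right hδ]
      have hℓδ : δ ≤ ℓ := le_trans (le_trans (le_trans (le_max_right _ _) (le_max_right _ _)) (le_max_left _ _)) hℓ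
      linarith
    have h4 : (2 * ℓ / δ + 1) ^ 3 ≤ (3 * ℓ / δ) ^ 3 := pow_le_pow_left₀ (by positivity) h3 3
    calc (F.card : ℝ) ≤ (2 * ℓ / δ + 1) ^ 3 := hbox
      _ ≤ (3 * ℓ / δ) ^ 3 := h4
      _ = B * ℓ ^ 3 := by rw [hB]; field_simp; ring
  have hN₁N : N₁ ≤ F.card := by
    have h1 : A * (N₁ : ℝ) ≤ κ * ℓ := by
      rw [div_le_iff₀ hκ] at hℓN
      linarith
    have h2 : κ * ℓ ≤ κ * ℓ ^ 3 := mul_le_mul_of_nonneg_left hℓ3 hκ.le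
    have h3 : A * (N₁ : ℝ) ≤ A * (F.card : ℝ) := h1.trans (h2.trans hNlow)
    exact_mod_cast le_of_mul_le_mul_left h3 hApos
  -- the two energy bounds
  have hE : groundStateEnergy lennardJones 3 F.card ≤ (e + ε) * F.card := hN₁ F.card hN₁N
  have hG : (F.card : ℝ) * e + shearGain u F ≤ 1 / 2 * ∑ y ∈ F, ∑ w ∈ F, lennardJones (dist y w) :=
    floor_add_shearGain_le F hu
  have herr : ε * F.card ≤ κ / 2 * ℓ ^ 3 := by
    have h1 : ε * F.card ≤ ε * (B * ℓ ^ 3) := mul_le_mul_of_nonneg_left hNB hεpos.le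
    have h2 : ε * (B * ℓ ^ 3) = κ / 2 * ℓ ^ 3 := by
      rw [hε]
      field_simp
    linarith
  refine ⟨ℓ, hℓ₀, c, F, hFcoe, ?_⟩
  have hEe : groundStateEnergy lennardJones 3 F.card ≤ F.card * e + ε * F.card := by linarith
  linarith

/-- A texture that is not stress-free has strained cubes at some positive rate. -/
theorem strainedCubes_of_not_stressFree {Y : Set (EuclideanSpace ℝ (Fin 3))} (hY : UniformlyDiscrete Y) (h : ¬ StressFree Y) :
    ∃ κ : ℝ, 0 < κ ∧ StrainedCubes κ Y := by
  unfold StressFree at h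
  push Not at h
  obtain ⟨u, hu, κ, hκ, hS⟩ := h
  exact ⟨κ / 2, by positivity, strainedCubes_of_shearStrained hY hu hκ hS⟩

/-- Monotonicity of the shear-strain predicate in the rate. -/
theorem shearStrainedCubes_mono {κ κ' : ℝ} {u : EuclideanSpace ℝ (Fin 3)} {Y : Set (EuclideanSpace ℝ (Fin 3))} (hκ : κ' ≤ κ)
    (h : ShearStrainedCubes κ u Y) : ShearStrainedCubes κ' u Y := by
  intro ℓ₀
  obtain ⟨ℓ, hℓ, c, F, hF, hg⟩ := h (max ℓ₀ 0)
  refine ⟨ℓ, (le_max_left _ _).trans hℓ, c, F, hF, le_trans ?_ hg⟩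
  have hℓ0 : 0 ≤ ℓ := (le_max_right _ _).trans hℓ
  exact mul_le_mul_of_nonneg_right hκ (pow_nonneg hℓ0 3)

/-! ## §4 The shrunken residual and the cone -/

/-- **The residual after the shear test `ShearFreeLiouvilleLaw T₀ D`**: `BalancedLiouvilleLaw` restricted to STRESS-FREE textures — a
uniformly recurrent clean texture with no compressed clean scale, sparse charge, locally optimal, virial-balanced AND stress-free in every
direction, that is `(t, L)`-strained at every admissible scale, has strained cubes.  KERNEL-WEAKER than `BalancedLiouvilleLaw`.
Its antecedent contains no homogeneously (affinely) strained Barlow texture: only inhomogeneous equilibrated strain fields with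
vanishing cube-averaged stress remain — conjecturally none with `L`-dense 4 %-features (discrete elastic Liouville). [piece] -/
def ShearFreeLiouvilleLaw (T₀ D : ℝ) : Prop :=
  ∀ Y : Set (EuclideanSpace ℝ (Fin 3)), CleanClass T₀ D Y → ¬ HasCompressedScale T₀ Y → SparseCharge Y → LocallyOptimal Y →
    VirialBalanced Y → StressFree Y → ∀ t : ℝ, 0 < t → ∀ L : ℝ, (∀ a' : ℝ, 47 / 50 ≤ a' → a' ≤ 1 → ViolatorsL a' t L Y) →
      ∃ κ : ℝ, 0 < κ ∧ StrainedCubes κ Y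

/-- The uncompressed residual from the shear-free residual (exhaustive case split on `StressFree Y`; the shear test discharges the
other case). [this file] -/
theorem balancedLiouvilleLaw_of_shearFree {T₀ D : ℝ} (h : ShearFreeLiouvilleLaw T₀ D) : BalancedLiouvilleLaw T₀ D := by
  intro Y hY hnc hsc hlo hvb t ht L hV
  by_cases hsf : StressFree Y
  · exact h Y hY hnc hsc hlo hvb hsf t ht L hV
  · exact strainedCubes_of_not_stressFree hY.1 hsf

/-- Converse: the shear-free residual is KERNEL-WEAKER than the uncompressed residual. [this file] -/
theorem shearFreeLiouvilleLaw_of_balanced {T₀ D : ℝ} (h : BalancedLiouvilleLaw T₀ D) : ShearFreeLiouvilleLaw T₀ D :=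
  fun Y hY hnc hsc hlo hvb _ t ht L hV => h Y hY hnc hsc hlo hvb t ht L hV

/-- … hence KERNEL-WEAKER than RELAX. [this file] -/
theorem shearFreeLiouvilleLaw_of_edgeRelaxationLaw {T₀ D : ℝ} (h : EdgeRelaxationLaw T₀ D) : ShearFreeLiouvilleLaw T₀ D :=
  shearFreeLiouvilleLaw_of_balanced (balancedLiouvilleLaw_of_edgeRelaxationLaw h)

/-- RELAX from the shared crux, the local test, the virial law and the shear-free residual. [this file] -/
theorem edgeRelaxationLaw_of_ceg_local_virial_shearFree {T₀ D : ℝ} (hCEG : ChargedEnergyGap) (hL : LocalRelaxationTest T₀ D)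
    (hC : CompressedVirialLaw T₀ D) (hS : ShearFreeLiouvilleLaw T₀ D) : EdgeRelaxationLaw T₀ D :=
  edgeRelaxationLaw_of_ceg_local_virial_balanced hCEG hL hC (balancedLiouvilleLaw_of_shearFree hS)

/-- **The g27 cone after the shear test (record parameters)**: `GrossCleanBallsU (1/250) 10 → ChargedEnergyGap →
LocalRelaxationTest (1/250) 10 → CompressedVirialLaw (1/250) 10 → ShearFreeLiouvilleLaw (1/250) 10 → CleanlessExcessT →
CoherentResidual 10 → RobustDefectLimitWindows`. [this file] -/
theorem rdef_of_grossU_shearSplit_record (hG : GrossCleanBallsU (1 / 250) 10) (hCEG : ChargedEnergyGap)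
    (hL : LocalRelaxationTest (1 / 250) 10) (hC : CompressedVirialLaw (1 / 250) 10) (hS : ShearFreeLiouvilleLaw (1 / 250) 10)
    (hCE : CleanlessExcessT) (hR : CoherentResidual 10) : RobustDefectLimitWindows :=
  rdef_of_grossU_scaleSplit_record hG hCEG hL hC (balancedLiouvilleLaw_of_shearFree hS) hCE hR

end Summit.AtomisticToContinuum.Crystallization.Theorems.OverbindingBudgetElasticSplitShear
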